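import Mathlib
import Literature.Computability.Complexity.RandomKSatEnsembleOGP

/-!
# Route OverlapGapAlgebra, crux `SearchHardWindow` (stmt-PneNP-2460): chain-mass bookkeeping

For the `ε`-resampling Markov chain on a finite product space `ι → Γ` (Huang–Sellke 2025 §3.3.2;
vocabulary `resampleKernel`, `resampleChainMass` of
`Literature/Computability/Complexity/RandomKSatEnsembleOGP.lean`) the mass of an event `E` on paths
is the finite weighted count
`resampleChainMass ε K E = (Σ_y (∏_{t<K} P_ε(y t, y (t+1))) · [E (t ↦ y (min t K))]) / #(ι → Γ)`,
the sum ranging over `y : Fin (K+1) → ι → Γ`.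

`stub_chainMassBasic` records three bookkeeping facts used by the assembly of line `Sketch`:
(1) the mass is monotone in the event and (2) subadditive under `∨` — both because the path weights
`∏_t P_ε(y t, y (t+1))` are nonnegative for `0 ≤ ε ≤ 1` (each kernel factor is
`(1 − ε)·{0,1} + ε/|Γ| ≥ 0`, as in `stub_resampleKernelBasic` (a) of
`Theorems/OverlapGapAlgebraSearchHardWindowResampleKernelBasic.lean`) and the indicators satisfy
`[E] ≤ [E']` for `E → E'` and `[E ∨ E'] ≤ [E] + [E']`; and (3) on the event "good at all times
`≤ K` and close at all steps `< K`" the mass times `#(ι → Γ)` is literally the path sum indexed by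
`Fin (K+1)` / `Fin K` (the `ℕ`-indexed path `t ↦ y (min t K)` evaluates to `y t` for `t ≤ K` and
to `y (t+1)` at `t + 1` for `t < K`).
-/

set_option linter.dupNamespace false -- `Summit.PneNP.PneNP.…`: summit = sub-problem

namespace Summit.PneNP.PneNP.Theorems

open Finset
open Literature.Computability.Complexity
open scoped Classical

/-- The resampling kernel `P_ε(y, y') = ∏_i ((1 − ε)·[y i = y' i] + ε/|Γ|)` is nonnegative for
`0 ≤ ε ≤ 1`: each factor is the sum of `(1 − ε)·{0, 1} ≥ 0` and `ε/|Γ| ≥ 0`. -/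
theorem cmb_kernel_nonneg {ι Γ : Type*} [Fintype ι] [Fintype Γ] [DecidableEq Γ] (ε : ℝ)
    (hε0 : 0 ≤ ε) (hε1 : ε ≤ 1) (y y' : ι → Γ) : 0 ≤ resampleKernel ε y y' := by
  unfold resampleKernel
  refine Finset.prod_nonneg fun i _ => add_nonneg ?_ (div_nonneg hε0 (Nat.cast_nonneg _))
  exact mul_nonneg (sub_nonneg.mpr hε1) (by split_ifs <;> norm_num)

/-- Path weights `∏_{t<K} P_ε(y t, y (t+1))` of the resampling chain are nonnegative. -/
theorem cmb_pathWeight_nonneg {ι Γ : Type*} [Fintype ι] [Fintype Γ] [DecidableEq Γ] (ε : ℝ)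
    (hε0 : 0 ≤ ε) (hε1 : ε ≤ 1) (K : ℕ) (y : Fin (K + 1) → ι → Γ) :
    0 ≤ ∏ t : Fin K, resampleKernel ε (y t.castSucc) (y t.succ) :=
  Finset.prod_nonneg fun _ _ => cmb_kernel_nonneg ε hε0 hε1 _ _

/-- Indicators are monotone: `[p] ≤ [q]` when `p → q` (any `Decidable` instances). -/
theorem cmb_ite_le_ite_of_imp {p q : Prop} {hp : Decidable p} {hq : Decidable q} (h : p → q) :
    @ite ℝ p hp 1 0 ≤ @ite ℝ q hq 1 0 := by
  by_cases hp' : p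
  · rw [if_pos hp', if_pos (h hp')]
  · by_cases hq' : q
    · rw [if_neg hp', if_pos hq']
      exact zero_le_one
    · rw [if_neg hp', if_neg hq']

/-- Indicators are subadditive: `[p ∨ q] ≤ [p] + [q]` (any `Decidable` instances). -/
theorem cmb_ite_or_le {p q : Prop} {hp : Decidable p} {hq : Decidable q} {hpq : Decidable (p ∨ q)} :
    @ite ℝ (p ∨ q) hpq 1 0 ≤ @ite ℝ p hp 1 0 + @ite ℝ q hq 1 0 := by
  by_cases hp' : p
  · rw [if_pos (Or.inl hp'), if_pos hp']
    by_cases hq' : q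
    · rw [if_pos hq']
      norm_num
    · rw [if_neg hq', add_zero]
  · rw [if_neg hp', zero_add]
    by_cases hq' : q
    · rw [if_pos (Or.inr hq'), if_pos hq']
    · rw [if_neg hq', if_neg (not_or.mpr ⟨hp', hq'⟩)]

/-- Indicators of equivalent propositions agree (any `Decidable` instances). -/
theorem cmb_ite_congr {p q : Prop} {hp : Decidable p} {hq : Decidable q} (h : p ↔ q) :
    @ite ℝ p hp 1 0 = @ite ℝ q hq 1 0 := by
  by_cases hq' : q
  · rw [if_pos hq', if_pos (h.2 hq')]
  · rw [if_neg hq', if_neg (mt h.1 hq')]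

/-- The clamped time `min t K` of a time `t : Fin (K+1)` is `t` itself. -/
theorem cmb_minFin_eq (K : ℕ) (t : Fin (K + 1)) :
    (⟨min (t : ℕ) K, Nat.lt_succ_of_le (Nat.min_le_right _ _)⟩ : Fin (K + 1)) = t :=
  Fin.ext (min_eq_left (Nat.lt_succ_iff.1 t.2))

/-- The clamped time `min t K` of a step `t : Fin K` is `t.castSucc`. -/
theorem cmb_minFin_eq_castSucc (K : ℕ) (t : Fin K) :
    (⟨min (t : ℕ) K, Nat.lt_succ_of_le (Nat.min_le_right _ _)⟩ : Fin (K + 1)) = t.castSucc :=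
  Fin.ext (min_eq_left (le_of_lt t.2))

/-- The clamped time `min (t + 1) K` after a step `t : Fin K` is `t.succ`. -/
theorem cmb_minFin_succ_eq_succ (K : ℕ) (t : Fin K) :
    (⟨min ((t : ℕ) + 1) K, Nat.lt_succ_of_le (Nat.min_le_right _ _)⟩ : Fin (K + 1)) = t.succ :=
  Fin.ext (min_eq_left (Nat.succ_le_of_lt t.2))

/-- The "good at all times `≤ K`, close at all steps `< K`" event, read on the `ℕ`-indexed path
`t ↦ y (min t K)`, is the `Fin`-indexed conjunction. -/
theorem cmb_goodClose_iff {α : Type*} (K : ℕ) (y : Fin (K + 1) → α) (good : α → Bool)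
    (close : α → α → Bool) :
    ((∀ t ≤ K, good (y ⟨min t K, Nat.lt_succ_of_le (Nat.min_le_right t K)⟩) = true) ∧
        ∀ t < K, close (y ⟨min t K, Nat.lt_succ_of_le (Nat.min_le_right t K)⟩)
          (y ⟨min (t + 1) K, Nat.lt_succ_of_le (Nat.min_le_right (t + 1) K)⟩) = true) ↔
      ((∀ t, good (y t) = true) ∧ ∀ t : Fin K, close (y t.castSucc) (y t.succ) = true) := by
  constructor
  · rintro ⟨hg, hc⟩
    refine ⟨fun t => ?_, fun t => ?_⟩
    · have h := hg t (Nat.lt_succ_iff.1 t.2)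
      rwa [cmb_minFin_eq K t] at h
    · have h := hc t t.2
      rwa [cmb_minFin_eq_castSucc K t, cmb_minFin_succ_eq_succ K t] at h
  · rintro ⟨hg, hc⟩
    refine ⟨fun t _ => hg _, fun t ht => ?_⟩
    have e1 : (⟨min t K, Nat.lt_succ_of_le (Nat.min_le_right t K)⟩ : Fin (K + 1)) =
        Fin.castSucc ⟨t, ht⟩ := Fin.ext (min_eq_left ht.le)
    have e2 : (⟨min (t + 1) K, Nat.lt_succ_of_le (Nat.min_le_right (t + 1) K)⟩ : Fin (K + 1)) =
        Fin.succ ⟨t, ht⟩ := Fin.ext (min_eq_left (Nat.succ_le_of_lt ht))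
    rw [e1, e2]
    exact hc ⟨t, ht⟩

/-- **Chain-mass bookkeeping** for the `ε`-resampling chain (`0 ≤ ε ≤ 1`): `resampleChainMass ε K`
is (1) monotone and (2) subadditive in the event (the path weights are nonnegative), and (3) on the
event "good at all times `≤ K` and close at all steps `< K`" the mass times `#(ι → Γ)` is the path
sum `Σ_y (∏_{t<K} P_ε(y t, y (t+1))) · [∀ t, good (y t)] · [∀ t < K, close (y t) (y (t+1))]`
indexed by `Fin (K+1)` / `Fin K` (the form of the grand-correlation lemma). -/
theorem stub_chainMassBasic {ι Γ : Type*} [Fintype ι] [DecidableEq ι] [Fintype Γ] [DecidableEq Γ]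
    [Nonempty Γ] (ε : ℝ) (hε0 : 0 ≤ ε) (hε1 : ε ≤ 1) (K : ℕ) :
    (∀ E E' : (ℕ → ι → Γ) → Prop, (∀ z, E z → E' z) →
        resampleChainMass ε K E ≤ resampleChainMass ε K E') ∧
    (∀ E E' : (ℕ → ι → Γ) → Prop,
        resampleChainMass ε K (fun z => E z ∨ E' z) ≤
          resampleChainMass ε K E + resampleChainMass ε K E') ∧
    (∀ (good : (ι → Γ) → Bool) (close : (ι → Γ) → (ι → Γ) → Bool),
        resampleChainMass ε K (fun z => (∀ t ≤ K, good (z t) = true) ∧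
            ∀ t < K, close (z t) (z (t + 1)) = true) * Fintype.card (ι → Γ) =
          ∑ y : Fin (K + 1) → ι → Γ, (∏ t : Fin K, resampleKernel ε (y t.castSucc) (y t.succ)) *
            (if (∀ t, good (y t) = true) ∧ (∀ t : Fin K, close (y t.castSucc) (y t.succ) = true)
              then (1 : ℝ) else 0)) := by
  refine ⟨fun E E' hEE' => ?_, fun E E' => ?_, fun good close => ?_⟩
  · -- (1) monotonicity
    unfold resampleChainMass
    refine div_le_div_of_nonneg_right (Finset.sum_le_sum fun y _ => ?_) (Nat.cast_nonneg _)
    exact mul_le_mul_of_nonneg_left (cmb_ite_le_ite_of_imp (hEE' _))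
      (cmb_pathWeight_nonneg ε hε0 hε1 K y)
  · -- (2) subadditivity
    unfold resampleChainMass
    rw [← add_div, ← Finset.sum_add_distrib]
    refine div_le_div_of_nonneg_right (Finset.sum_le_sum fun y _ => ?_) (Nat.cast_nonneg _)
    rw [← mul_add]
    exact mul_le_mul_of_nonneg_left cmb_ite_or_le (cmb_pathWeight_nonneg ε hε0 hε1 K y)
  · -- (3) the good/close event is the `Fin`-indexed path sum
    have hcard : (Fintype.card (ι → Γ) : ℝ) ≠ 0 := by exact_mod_cast Fintype.card_ne_zero
    unfold resampleChainMass
    rw [div_mul_cancel₀ _ hcard]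
    refine Finset.sum_congr rfl fun y _ => ?_
    congr 1
    exact cmb_ite_congr (cmb_goodClose_iff K y good close)

end Summit.PneNP.PneNP.Theorems
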